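import Mathlib
import Summits.NavierStokesRegularity.NavierStokesRegularity.Theorems.EulerZoomLiouvillePowerGaugeEulerLiouvilleCondenserShellSummation

/-!
# (W4′) THE WEIGHTED WINDOW BUDGET and (W4) WINDOW SUMMATION — plates of nsreg-p2 ROUND-47 v1.3 §5b «THE MASTER FORM
along ARBITRARY DISJOINT WINDOWS» (`r47/Sketch47.lean` sha16 f89f412bf4150db7, texts VERBATIM)

Width piece for crux `EulerZoomLiouville.PowerGaugeEulerLiouville` (stmt-NavierStokesRegularity-19832), by name under
LEAD 19832 (ns-typeII-p2 g14) and planner nsreg-p2 g37 (key 01:02:33Z); seat ns-ezl-w2 g5,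
`--supports stmt-NavierStokesRegularity-19832 --as helper`.  Consumer: ns-sfl-p1 g7's THEOREM K^Σ′
`WindowSummabilityLiouville` (master form containing the LEAD's T3, K∞ and K^Σ).

These are (W3′)/(W3) of `…CondenserShellSummation` with the geometric shells `qᵏL₀` replaced by ARBITRARY pairwise
disjoint windows `[ℓ_k, qℓ_k)` (`qℓ_k ≤ ℓ_{k+1}`) and, in (W4), a general per-window cost `κ·ℓ_k³/G_k`:

* `weightedWindowBudget` = `NsregP2.R47.WeightedWindowBudget` (W4′, EXACT, S+): for `V ∈ C¹`, `ρ < 1`, `q > 1`, `ℓ_k > 0`,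
  `qℓ_k ≤ ℓ_{k+1}`, `B ≥ 0` with `∫⁻ ‖DV‖ₑ²‖y‖^{ρ−1} ≤ B`:
  `Σ_{k<n} (qℓ_k)^{ρ−1}(∫_{B(0,qℓ_k)}‖DV‖² − ∫_{B(0,ℓ_k)}‖DV‖²) ≤ B` for every `n` (layer cake on the disjoint shells
  `B(0,qℓ_k) ∖ B(0,ℓ_k)`, where `‖y‖^{ρ−1} ≥ (qℓ_k)^{ρ−1}`).
* `windowSummation` = `NsregP2.R47.WindowSummation` (W4, EXACT, S): if those partial sums (for an abstract `F`) are `≤ B`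
  and window `k` pays `F(qℓ_k) − F(ℓ_k) ≥ κℓ_k³/G_k` (`κ, G_k > 0`), then `Σ_k ℓ_k^{2+ρ}/G_k` converges (the `k`-th
  weighted increment is `≥ κq^{ρ−1}·ℓ_k^{2+ρ}/G_k ≥ 0`, so the partial sums of the nonnegative series are
  `≤ Bq^{1−ρ}/κ`; `summable_of_sum_range_le`).

HONEST FRAMING: finite sums and measure theory on the MODEL lattice of crux E; proves nothing about the crux (19832 OPEN),
about `Sig.stub_selfSimilarC2Needle`, about K^Σ′ itself, or about Navier–Stokes regularity; no hard core is touched.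
[folklore]
-/

noncomputable section

open Set Filter Topology Metric Function MeasureTheory
open scoped ENNReal NNReal

set_option linter.dupNamespace false

namespace Summit.NavierStokesRegularity.NavierStokesRegularity.Theorems.PowerGaugeEulerLiouville.Condenser

/-! ## (W4′) The weighted window budget -/

/-- Windows `[ℓ_k, qℓ_k)` with `q ≥ 1`, `ℓ_k > 0`, `qℓ_k ≤ ℓ_{k+1}` are increasing and separated: `ℓ` is monotone and
`qℓ_i ≤ ℓ_j` for `i < j`. [folklore] -/
theorem window_separated {q : ℝ} {ℓ : ℕ → ℝ} (hq : 1 ≤ q) (hℓ : ∀ k, 0 < ℓ k) (hsep : ∀ k, q * ℓ k ≤ ℓ (k + 1)) :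
    Monotone ℓ ∧ ∀ {i j : ℕ}, i < j → q * ℓ i ≤ ℓ j := by
  have hmono : Monotone ℓ := monotone_nat_of_le_succ fun k =>
    (le_mul_of_one_le_left (hℓ k).le hq).trans (hsep k)
  exact ⟨hmono, fun {i j} hij => (hsep i).trans (hmono (Nat.succ_le_of_lt hij))⟩

/-- **(W4′) THE WEIGHTED WINDOW BUDGET**, working form.  For `V ∈ C¹(ℝ³;ℝ³)`, `ρ < 1`, `q > 1`, windows `ℓ_k > 0` with
`qℓ_k ≤ ℓ_{k+1}`, and `B ≥ 0` with `∫⁻ ‖DV(y)‖ₑ² ‖y‖^{ρ−1} dy ≤ B`: for every `n`,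
`Σ_{k<n} (qℓ_k)^{ρ−1}(∫_{B(0,qℓ_k)}‖DV‖² − ∫_{B(0,ℓ_k)}‖DV‖²) ≤ B`.  Proof = (W3′)'s layer cake on the pairwise disjoint
shells `B(0,qℓ_k) ∖ B(0,ℓ_k)`. [folklore] -/
theorem weightedWindowBudget_of {V : EuclideanSpace ℝ (Fin 3) → EuclideanSpace ℝ (Fin 3)} {ρ B q : ℝ} {ℓ : ℕ → ℝ}
    (hV : ContDiff ℝ 1 V) (hρ : ρ < 1) (hq : 1 < q) (hℓ : ∀ k : ℕ, 0 < ℓ k) (hsep : ∀ k : ℕ, q * ℓ k ≤ ℓ (k + 1))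
    (hB : 0 ≤ B) (hE : ∫⁻ y, ‖fderiv ℝ V y‖ₑ ^ 2 * ENNReal.ofReal (‖y‖ ^ (ρ - 1)) ≤ ENNReal.ofReal B) (n : ℕ) :
    ∑ k ∈ Finset.range n,
        (q * ℓ k) ^ (ρ - 1) *
          ((∫ z in ball (0 : EuclideanSpace ℝ (Fin 3)) (q * ℓ k), ‖fderiv ℝ V z‖ ^ 2) -
            ∫ z in ball (0 : EuclideanSpace ℝ (Fin 3)) (ℓ k), ‖fderiv ℝ V z‖ ^ 2) ≤ B := by
  obtain ⟨-, hsep'⟩ := window_separated hq.le hℓ hsep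
  have hqℓ : ∀ k, ℓ k ≤ q * ℓ k := fun k => le_mul_of_one_le_left (hℓ k).le hq.le
  -- the integrand and the weighted integrand
  set f : EuclideanSpace ℝ (Fin 3) → ℝ := fun z => ‖fderiv ℝ V z‖ ^ 2 with hf
  have hfc : Continuous f := ((hV.continuous_fderiv one_ne_zero).norm).pow 2
  have hf0 : ∀ z, 0 ≤ f z := fun z => sq_nonneg _
  set g : EuclideanSpace ℝ (Fin 3) → ℝ := fun z => f z * ‖z‖ ^ (ρ - 1) with hg
  have hg0 : ∀ z, 0 ≤ g z := fun z => mul_nonneg (hf0 z) (Real.rpow_nonneg (norm_nonneg _) _)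
  have hgm : Measurable g := hfc.measurable.mul (continuous_norm.measurable.pow_const _)
  -- the shells
  set S : ℕ → Set (EuclideanSpace ℝ (Fin 3)) := fun k =>
    ball (0 : EuclideanSpace ℝ (Fin 3)) (q * ℓ k) \ ball 0 (ℓ k) with hS
  have hSm : ∀ k, MeasurableSet (S k) := fun k => measurableSet_ball.diff measurableSet_ball
  have hSmem : ∀ k, ∀ z ∈ S k, ℓ k ≤ ‖z‖ ∧ ‖z‖ < q * ℓ k := by
    intro k z hz
    simp only [hS, Set.mem_sdiff, mem_ball, dist_zero_right, not_lt] at hz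
    exact ⟨hz.2, hz.1⟩
  have hfi : ∀ R : ℝ, IntegrableOn f (ball (0 : EuclideanSpace ℝ (Fin 3)) R) := fun R =>
    (hfc.continuousOn.integrableOn_compact (isCompact_closedBall 0 R)).mono_set ball_subset_closedBall
  -- the increment is the shell integral
  have hshell : ∀ k : ℕ, (∫ z in ball (0 : EuclideanSpace ℝ (Fin 3)) (q * ℓ k), f z) -
      ∫ z in ball (0 : EuclideanSpace ℝ (Fin 3)) (ℓ k), f z = ∫ z in S k, f z := fun k => by
    rw [hS, setIntegral_sdiff measurableSet_ball (hfi _) (ball_subset_ball (hqℓ k))]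
  -- the weighted integrand is integrable on each shell and dominates the weighted increment
  have hgi : ∀ k : ℕ, IntegrableOn g (S k) := by
    intro k
    have hK : IsCompact (closedBall (0 : EuclideanSpace ℝ (Fin 3)) (q * ℓ k) ∩ {z | ℓ k ≤ ‖z‖}) :=
      (isCompact_closedBall _ _).inter_right (isClosed_le continuous_const continuous_norm)
    have hcont : ContinuousOn g (closedBall (0 : EuclideanSpace ℝ (Fin 3)) (q * ℓ k) ∩ {z | ℓ k ≤ ‖z‖}) := by
      refine hfc.continuousOn.mul (continuous_norm.continuousOn.rpow_const fun z hz => Or.inl ?_)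
      exact ne_of_gt ((hℓ k).trans_le hz.2)
    refine (hcont.integrableOn_compact hK).mono_set fun z hz => ?_
    obtain ⟨h1, h2⟩ := hSmem k z hz
    exact ⟨mem_closedBall_zero_iff.2 h2.le, h1⟩
  have hwk : ∀ k : ℕ, (q * ℓ k) ^ (ρ - 1) * ∫ z in S k, f z ≤ ∫ z in S k, g z := by
    intro k
    rw [← integral_const_mul]
    refine setIntegral_mono_on (((hfi _).mono_set sdiff_subset).const_mul _) (hgi k) (hSm k) fun z hz => ?_
    obtain ⟨h1, h2⟩ := hSmem k z hz
    have hzpos : 0 < ‖z‖ := (hℓ k).trans_le h1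
    have hle : (q * ℓ k) ^ (ρ - 1) ≤ ‖z‖ ^ (ρ - 1) := Real.rpow_le_rpow_of_nonpos hzpos h2.le (by linarith)
    calc (q * ℓ k) ^ (ρ - 1) * f z ≤ ‖z‖ ^ (ρ - 1) * f z := mul_le_mul_of_nonneg_right hle (hf0 z)
      _ = g z := by rw [hg, mul_comm]
  -- the shells are pairwise disjoint
  have hdisj : Set.Pairwise (↑(Finset.range n)) (Disjoint on S) := by
    intro i _ j _ hij
    rcases lt_or_gt_of_ne hij with h | h
    · refine disjoint_left.2 fun z hzi hzj => ?_
      have h1 := (hSmem i z hzi).2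
      have h2 := (hSmem j z hzj).1
      have h3 : q * ℓ i ≤ ℓ j := hsep' h
      linarith
    · refine disjoint_left.2 fun z hzi hzj => ?_
      have h1 := (hSmem j z hzj).2
      have h2 := (hSmem i z hzi).1
      have h3 : q * ℓ j ≤ ℓ i := hsep' h
      linarith
  have hU : ∫ z in ⋃ k ∈ Finset.range n, S k, g z = ∑ k ∈ Finset.range n, ∫ z in S k, g z :=
    integral_biUnion_finset _ (fun k _ => hSm k) hdisj fun k _ => hgi k
  -- the union integral is bounded by the global weighted budget
  have hUB : ∫ z in ⋃ k ∈ Finset.range n, S k, g z ≤ B := by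
    rw [integral_eq_lintegral_of_nonneg_ae (ae_of_all _ fun z => hg0 z) hgm.aestronglyMeasurable]
    refine ENNReal.toReal_le_of_le_ofReal hB ?_
    calc ∫⁻ z in ⋃ k ∈ Finset.range n, S k, ENNReal.ofReal (g z)
        ≤ ∫⁻ z, ENNReal.ofReal (g z) := setLIntegral_le_lintegral _ _
      _ = ∫⁻ y, ‖fderiv ℝ V y‖ₑ ^ 2 * ENNReal.ofReal (‖y‖ ^ (ρ - 1)) := by
          refine lintegral_congr fun y => ?_
          rw [hg, hf, ENNReal.ofReal_mul (sq_nonneg _), ← ofReal_norm, ENNReal.ofReal_pow (norm_nonneg _)]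
      _ ≤ ENNReal.ofReal B := hE
  -- assemble
  calc ∑ k ∈ Finset.range n, (q * ℓ k) ^ (ρ - 1) *
        ((∫ z in ball (0 : EuclideanSpace ℝ (Fin 3)) (q * ℓ k), f z) -
          ∫ z in ball (0 : EuclideanSpace ℝ (Fin 3)) (ℓ k), f z)
      = ∑ k ∈ Finset.range n, (q * ℓ k) ^ (ρ - 1) * ∫ z in S k, f z :=
        Finset.sum_congr rfl fun k _ => by rw [hshell k]
    _ ≤ ∑ k ∈ Finset.range n, ∫ z in S k, g z := Finset.sum_le_sum fun k _ => hwk k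
    _ = ∫ z in ⋃ k ∈ Finset.range n, S k, g z := hU.symm
    _ ≤ B := hUB

/-- **(W4′) `NsregP2.R47.WeightedWindowBudget`, binder-for-binder** (Sketch47 v1.3 of nsreg-p2 g37, §5b; `E3` written out).
[folklore] -/
theorem weightedWindowBudget :
    ∀ (V : EuclideanSpace ℝ (Fin 3) → EuclideanSpace ℝ (Fin 3)) (ρ B q : ℝ) (ℓ : ℕ → ℝ), ContDiff ℝ 1 V → ρ < 1 →
      1 < q → (∀ k : ℕ, 0 < ℓ k) → (∀ k : ℕ, q * ℓ k ≤ ℓ (k + 1)) → 0 ≤ B →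
      ∫⁻ y, ‖fderiv ℝ V y‖ₑ ^ 2 * ENNReal.ofReal (‖y‖ ^ (ρ - 1)) ≤ ENNReal.ofReal B →
      ∀ n : ℕ, ∑ k ∈ Finset.range n,
          (q * ℓ k) ^ (ρ - 1) *
            ((∫ z in ball (0 : EuclideanSpace ℝ (Fin 3)) (q * ℓ k), ‖fderiv ℝ V z‖ ^ 2) -
              ∫ z in ball (0 : EuclideanSpace ℝ (Fin 3)) (ℓ k), ‖fderiv ℝ V z‖ ^ 2) ≤ B :=
  fun _ _ _ _ _ hV hρ hq hℓ hsep hB hE n => weightedWindowBudget_of hV hρ hq hℓ hsep hB hE n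

/-! ## (W4) Window summation -/

/-- **(W4) WINDOW SUMMATION**, working form.  If the weighted window increments of `F` have partial sums `≤ B` and window
`k` pays `F(qℓ_k) − F(ℓ_k) ≥ κℓ_k³/G_k` (`q > 1`, `κ > 0`, `ℓ_k > 0`, `G_k > 0`), then `Σ_k ℓ_k^{2+ρ}/G_k` converges: the
`k`-th increment is `≥ (qℓ_k)^{ρ−1}κℓ_k³/G_k = κq^{ρ−1}·ℓ_k^{2+ρ}/G_k ≥ 0`, so the partial sums of the nonnegative series are
`≤ Bq^{1−ρ}/κ` (`summable_of_sum_range_le`).  The binder `ρ < 1` is idle. [folklore] -/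
theorem windowSummation_of {F : ℝ → ℝ} {ρ κ q B : ℝ} {ℓ G : ℕ → ℝ} (hq : 1 < q) (hκ : 0 < κ)
    (hℓ : ∀ k : ℕ, 0 < ℓ k) (hG : ∀ k : ℕ, 0 < G k)
    (hsum : ∀ n : ℕ, ∑ k ∈ Finset.range n, (q * ℓ k) ^ (ρ - 1) * (F (q * ℓ k) - F (ℓ k)) ≤ B)
    (hwin : ∀ k : ℕ, κ * ℓ k ^ 3 / G k ≤ F (q * ℓ k) - F (ℓ k)) :
    Summable (fun k : ℕ => ℓ k ^ (2 + ρ) / G k) := by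
  have hq0 : 0 < q := zero_lt_one.trans hq
  set c₀ : ℝ := κ * q ^ (ρ - 1) with hc₀
  have hc₀pos : 0 < c₀ := mul_pos hκ (Real.rpow_pos_of_pos hq0 _)
  have hnonneg : ∀ k : ℕ, 0 ≤ ℓ k ^ (2 + ρ) / G k := fun k =>
    div_nonneg (Real.rpow_nonneg (hℓ k).le _) (hG k).le
  -- each weighted increment dominates `c₀ · ℓ_k^{2+ρ}/G_k`
  have hterm : ∀ k : ℕ, c₀ * (ℓ k ^ (2 + ρ) / G k) ≤ (q * ℓ k) ^ (ρ - 1) * (F (q * ℓ k) - F (ℓ k)) := by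
    intro k
    have hw : 0 < (q * ℓ k) ^ (ρ - 1) := Real.rpow_pos_of_pos (mul_pos hq0 (hℓ k)) _
    have key : (q * ℓ k) ^ (ρ - 1) * (κ * ℓ k ^ 3 / G k) = c₀ * (ℓ k ^ (2 + ρ) / G k) := by
      have h3 : (ℓ k) ^ (3 : ℕ) = (ℓ k) ^ (3 : ℝ) := by rw [← Real.rpow_natCast]; norm_num
      have hadd : (ℓ k) ^ (ρ - 1) * (ℓ k) ^ (3 : ℝ) = (ℓ k) ^ (2 + ρ) := by
        rw [← Real.rpow_add (hℓ k)]; ring_nf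
      rw [Real.mul_rpow hq0.le (hℓ k).le, h3, hc₀]
      calc q ^ (ρ - 1) * ℓ k ^ (ρ - 1) * (κ * ℓ k ^ (3 : ℝ) / G k)
          = κ * q ^ (ρ - 1) * ((ℓ k ^ (ρ - 1) * ℓ k ^ (3 : ℝ)) / G k) := by ring
        _ = κ * q ^ (ρ - 1) * (ℓ k ^ (2 + ρ) / G k) := by rw [hadd]
    rw [← key]
    exact mul_le_mul_of_nonneg_left (hwin k) hw.le
  -- bounded partial sums of a nonnegative series
  refine summable_of_sum_range_le hnonneg (c := B / c₀) fun n => ?_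
  rw [le_div_iff₀ hc₀pos]
  calc (∑ k ∈ Finset.range n, ℓ k ^ (2 + ρ) / G k) * c₀ = ∑ k ∈ Finset.range n, c₀ * (ℓ k ^ (2 + ρ) / G k) := by
        rw [Finset.sum_mul]; exact Finset.sum_congr rfl fun k _ => mul_comm _ _
    _ ≤ ∑ k ∈ Finset.range n, (q * ℓ k) ^ (ρ - 1) * (F (q * ℓ k) - F (ℓ k)) :=
        Finset.sum_le_sum fun k _ => hterm k
    _ ≤ B := hsum n

/-- **(W4) `NsregP2.R47.WindowSummation`, binder-for-binder** (Sketch47 v1.3 of nsreg-p2 g37, §5b): bounded weighted window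
increments + a cost `κℓ_k³/G_k` per window ⇒ `Σ_k ℓ_k^{2+ρ}/G_k < ∞`; with `¬Summable` in K^Σ′ this is the contradiction.
[folklore] -/
theorem windowSummation :
    ∀ (F : ℝ → ℝ) (ρ κ q B : ℝ) (ℓ G : ℕ → ℝ), ρ < 1 → 1 < q → 0 < κ → (∀ k : ℕ, 0 < ℓ k) → (∀ k : ℕ, 0 < G k) →
      (∀ n : ℕ, ∑ k ∈ Finset.range n, (q * ℓ k) ^ (ρ - 1) * (F (q * ℓ k) - F (ℓ k)) ≤ B) →
      (∀ k : ℕ, κ * ℓ k ^ 3 / G k ≤ F (q * ℓ k) - F (ℓ k)) →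
      Summable (fun k : ℕ => ℓ k ^ (2 + ρ) / G k) :=
  fun _ _ _ _ _ _ _ _ hq hκ hℓ hG hsum hwin => windowSummation_of hq hκ hℓ hG hsum hwin

end Summit.NavierStokesRegularity.NavierStokesRegularity.Theorems.PowerGaugeEulerLiouville.Condenser

end
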